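import Summits.AnomalousDissipation.AnomalousDissipation.Theorems.WindLineWindyGalerkinSteadyZerothLawOfLoudNondegenerate
import Summits.AnomalousDissipation.AnomalousDissipation.Theorems.BaireTransferBaireStep
import Literature.Analysis.FluidPDE.LinearizedNSTorus
import Literature.Analysis.FunctionSpaces.TorusSymL2Synthesis

/-!
# `WindLine.WindyGalerkinSteadyZerothLaw` (stmt-AnomalousDissipation-11414): the BAIRE BIRTH of the heart (glue of line `registered`, rev 5)

Support file for the crux (lands `--supports stmt-AnomalousDissipation-11414`).  The line's transfer
(`windyGalerkinSteadyZerothLaw_of_loudNondegenerateSteadyStates`, this namespace) reduces the crux X to the HEART: loud, bounded,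
leaf-nondegenerate classical steady states of `NS_{ν_j}(f)` along `ν_j → 0⁺` for ONE smooth divergence-free mean-zero force.  This
file proves, sorry-free, that the heart — and hence X — follows from three statements over a Baire space of smooth forces:

* the PARAMETER SPACE `𝒜 ⊆ SymL2 (Fin 3)`: conjugation-symmetric square-summable coefficient families with no mean mode and
  transversal coefficients (closed, `isClosed_admissible`; complete hence Baire, `baireSpace_admissible`), with the FORCE MAP
  `F⟦c⟧ = SymL2.field (k ↦ e^{|k|²}) c` (the real field with Fourier coefficients `e^{−|k|²} c k`);
* (A) DENSE LOUD STEADY DESIGNER FORCES: along some `ν_j → 0⁺`, with pinned momenta `m_j` and fixed budgets, the parameters whose force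
  carries a classical steady state with `∫u = m_j`, `∫|u|² < E`, `ε < ν_j‖∇u‖²` are dense in a fixed non-empty open `U ⊆ 𝒜` at every level
  (the physics; no nondegeneracy, no robustness);
* (B) GENERIC LEAF-NONDEGENERACY (Foias–Temam 1976/77/78, Sard–Smale): at fixed `ν > 0` and momentum `m`, the parameters all of whose
  steady states of momentum `m` are leaf-nondegenerate have dense interior;
* (O) OPENNESS of the set of parameters carrying a leaf-nondegenerate loud bounded steady state of momentum `m` (steady IFT in the leaf);
* (D) the force dictionary (`F⟦c⟧` smooth, divergence free, mean zero).

`denseRobustNondegenerateLoud_of_dense` : A → B → O → R ("dense ∩ open-dense is dense"), `loudNondegenerateSteadyStates_of_robust` :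
D → R → HEART (Baire–Osgood through the landed `Theorems.BaireStep.baire_skeleton`), `windyGalerkinSteadyZerothLaw_of_baireBirth` :
A → B → O → D → X BY NAME.  All hypotheses are stated inline (they are the registered stubs of the line, proved elsewhere as they close).

References: Foias–Temam, LNM 565 (1976) 24–28 (Thm. 1; finite-mode Sard p. 26); Foias–Temam, CPAM 30 (1977) 149–164; Foias–Temam, Ann. SNS Pisa (4) 5
(1978) 29–63, Thm. 3.1–3.3; Saut–Temam, Comm. PDE 4 (1979) 293–319; Smale, Amer. J. Math. 87 (1965); Simon, Ann. Math. 141 (1995) (Baire–Osgood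
transfer); Temam, *Navier–Stokes Equations* (1979) Ch. II.  Route file `Theses/WindLine.lean`; skeleton `Cruxes/WindyGalerkinSteadyZerothLaw/Lines/birth.lean`.
-/

noncomputable section

-- D-0017: single-problem summit ⇒ the duplicated namespace segment is by design.
set_option linter.dupNamespace false

open scoped InnerProductSpace Topology ComplexConjugate
open MeasureTheory Filter UnitAddTorus Set
open Literature.Analysis.FunctionSpaces Literature.Analysis.FunctionSpaces.Torus
open Literature.Analysis.FunctionSpaces.EuclideanSpace
open Literature.Analysis.FluidPDE Literature.Analysis.FluidPDE.Torus

namespace Summit.AnomalousDissipation.AnomalousDissipation.Theorems.WindLineWindyGalerkinSteadyZerothLaw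

/-- The flat three-torus (local notation). -/
local notation "𝕋³" => UnitAddTorus (Fin 3)
/-- Velocity values (local notation). -/
local notation "E³" => EuclideanSpace ℝ (Fin 3)
set_option quotPrecheck false in
/-- **The admissible parameter set** `𝒜 ⊆ SymL2 (Fin 3)`: conjugation-symmetric square-summable families with no mean mode and
transversal coefficients (local notation; used as the TYPE `↥𝒜` of parameters). -/
local notation "𝒜" => ({c : SymL2 (Fin 3) | c 0 = 0 ∧
  ∀ k : Fin 3 → ℤ, ∑ j : Fin 3, ((k j : ℤ) : ℂ) * c k j = 0} : Set (SymL2 (Fin 3)))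
/-- **The force of a parameter**: the real field with Fourier coefficients `e^{−|k|²} c k` (Gaussian-damped synthesis `SymL2.field`
at the weight `k ↦ e^{|k|²}`; local notation). -/
local notation "F⟦" c "⟧" => SymL2.field (fun k : Fin 3 → ℤ => Real.exp (freqNormSq k)) (c : SymL2 (Fin 3))

/-- **`𝒜` is closed in `SymL2 (Fin 3)`**: it is the intersection of the zero sets of the continuous maps `c ↦ c 0` and
`c ↦ ∑ⱼ kⱼ (c k)ⱼ` (`SymL2.continuous_apply`, coordinates of `EuclideanSpace`). -/
theorem isClosed_admissible : IsClosed 𝒜 := by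
  have hcoord : ∀ (k : Fin 3 → ℤ) (j : Fin 3), Continuous fun c : SymL2 (Fin 3) => c k j := fun k j =>
    (EuclideanSpace.proj j).continuous.comp (SymL2.continuous_apply k)
  have h0 : IsClosed {c : SymL2 (Fin 3) | c 0 = 0} := isClosed_eq (SymL2.continuous_apply 0) continuous_const
  have hk : ∀ k : Fin 3 → ℤ, IsClosed {c : SymL2 (Fin 3) | ∑ j : Fin 3, ((k j : ℤ) : ℂ) * c k j = 0} :=
    fun k => isClosed_eq (continuous_finsetSum _ fun j _ => continuous_const.mul (hcoord k j)) continuous_const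
  have hset : 𝒜 = {c : SymL2 (Fin 3) | c 0 = 0} ∩
      ⋂ k : Fin 3 → ℤ, {c : SymL2 (Fin 3) | ∑ j : Fin 3, ((k j : ℤ) : ℂ) * c k j = 0} := by
    ext c
    simp only [mem_setOf_eq, mem_inter_iff, mem_iInter]
  rw [hset]
  exact h0.inter (isClosed_iInter hk)

/-- **`𝒜` is a Baire space**: a closed subset of the complete space `SymL2 (Fin 3)` is complete (`IsClosed.completeSpace_coe`), and
complete pseudo-metric spaces are Baire. -/
theorem baireSpace_admissible : BaireSpace 𝒜 := by
  haveI : CompleteSpace 𝒜 := isClosed_admissible.completeSpace_coe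
  infer_instance

/-- **A ∧ B ∧ O ⇒ R: dense loud forces + generic nondegeneracy + openness ⇒ dense ROBUSTLY nondegenerate-loud forces.**
At level `j`: the nondegenerate-loud set `N_j` is open (O), the regular set `G_j` has dense interior (B), and the loud set `L_j` is dense
in `U` (A).  For `x ∈ U` and an open `W ∋ x`, the open set `W ∩ U ∩ interior G_j` is non-empty (density of `interior G_j`) and — its
points lying in `U ⊆ closure L_j` — meets `L_j` at some `z`; the loud state at `z` is nondegenerate because `z ∈ G_j`, so `z ∈ W ∩ N_j`.
Hence `U ⊆ closure N_j = closure (interior N_j)`.  Hypotheses inline = the registered stubs `stub_denseLoudSteadyForces`,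
`stub_genericLeafNondegeneracy`, `stub_nondegenerateLoudOpen` of `Cruxes/WindyGalerkinSteadyZerothLaw/Lines/birth.lean`. -/
theorem denseRobustNondegenerateLoud_of_dense
    (hA : ∃ (ν : ℕ → ℝ) (m : ℕ → E³) (E ε : ℝ), (∀ j, 0 < ν j) ∧ Tendsto ν atTop (𝓝 0) ∧ 0 < ε ∧
      ∃ U : Set 𝒜, IsOpen U ∧ U.Nonempty ∧
        ∀ j, U ⊆ closure {c : 𝒜 | ∃ (u : 𝕋³ → E³) (p : 𝕋³ → ℝ),
          IsSteadyNSState (ν j) F⟦c⟧ u p ∧ ∫ x, u x = m j ∧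
            ∫ x, ‖u x‖ ^ 2 < E ∧ ε < ν j * gradNormSq u})
    (hB : ∀ (ν : ℝ) (m : E³), 0 < ν →
      Dense (interior {c : 𝒜 | ∀ (u : 𝕋³ → E³) (p : 𝕋³ → ℝ),
        IsSteadyNSState ν F⟦c⟧ u p → ∫ x, u x = m → ¬ IsLinNSEigenvalue ν u 0}))
    (hO : ∀ (ν : ℝ) (m : E³) (E ε : ℝ), 0 < ν →
      IsOpen {c : 𝒜 | ∃ (u : 𝕋³ → E³) (p : 𝕋³ → ℝ),
        IsSteadyNSState ν F⟦c⟧ u p ∧ ∫ x, u x = m ∧ ¬ IsLinNSEigenvalue ν u 0 ∧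
          ∫ x, ‖u x‖ ^ 2 < E ∧ ε < ν * gradNormSq u}) :
    ∃ (ν : ℕ → ℝ) (m : ℕ → E³) (E ε : ℝ), (∀ j, 0 < ν j) ∧ Tendsto ν atTop (𝓝 0) ∧ 0 < ε ∧
      ∃ U : Set 𝒜, IsOpen U ∧ U.Nonempty ∧
        ∀ j, U ⊆ closure (interior {c : 𝒜 | ∃ (u : 𝕋³ → E³) (p : 𝕋³ → ℝ),
          IsSteadyNSState (ν j) F⟦c⟧ u p ∧ ∫ x, u x = m j ∧ ¬ IsLinNSEigenvalue (ν j) u 0 ∧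
            ∫ x, ‖u x‖ ^ 2 < E ∧ ε < ν j * gradNormSq u}) := by
  obtain ⟨ν, m, E, ε, hν, hν0, hε, U, hUo, hUne, hU⟩ := hA
  refine ⟨ν, m, E, ε, hν, hν0, hε, U, hUo, hUne, fun j => ?_⟩
  have hGd := hB (ν j) (m j) (hν j)
  have hNo := hO (ν j) (m j) E ε (hν j)
  rw [hNo.interior_eq]
  intro x hxU
  rw [mem_closure_iff]
  intro W hW hxW
  -- the open set `W ∩ U` contains `x`, hence meets the dense `interior G_j` at some `y`
  obtain ⟨y, hyWU, hyG⟩ := hGd.inter_open_nonempty (W ∩ U) (hW.inter hUo) ⟨x, hxW, hxU⟩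
  -- `y ∈ U ⊆ closure L_j`, so the open neighbourhood `(W ∩ U) ∩ interior G_j` of `y` meets `L_j` at some `z`
  obtain ⟨z, ⟨⟨hzW, -⟩, hzG⟩, hzL⟩ :=
    mem_closure_iff.1 (hU j hyWU.2) _ ((hW.inter hUo).inter isOpen_interior) ⟨hyWU, hyG⟩
  obtain ⟨u, p, hst, hm, hE, hεu⟩ := hzL
  have hzG' := interior_subset hzG
  simp only [mem_setOf_eq] at hzG'
  exact ⟨z, hzW, u, p, hst, hm, hzG' u p hst hm, hE, hεu⟩

/-- **D ∧ R ⇒ HEART (Baire–Osgood).**  In the Baire space `𝒜`, if at every level the robustly nondegenerate-loud parameters are dense in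
the non-empty open `U`, then ONE parameter `c⋆ ∈ U` is nondegenerate-loud at every level (`Theorems.BaireStep.baire_skeleton`); its force
`F⟦c⋆⟧` is smooth, divergence free and mean zero (hypothesis D = registered stub `stub_forceDictionary`), and the witnesses are read off
level by level: this is VERBATIM the heart of the line (the hypothesis of `windyGalerkinSteadyZerothLaw_of_loudNondegenerateSteadyStates`). -/
theorem loudNondegenerateSteadyStates_of_robust
    (hD : ∀ c : 𝒜, IsSmooth F⟦c⟧ ∧ IsDivFree F⟦c⟧ ∧ HasZeroMean F⟦c⟧)
    (hR : ∃ (ν : ℕ → ℝ) (m : ℕ → E³) (E ε : ℝ), (∀ j, 0 < ν j) ∧ Tendsto ν atTop (𝓝 0) ∧ 0 < ε ∧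
      ∃ U : Set 𝒜, IsOpen U ∧ U.Nonempty ∧
        ∀ j, U ⊆ closure (interior {c : 𝒜 | ∃ (u : 𝕋³ → E³) (p : 𝕋³ → ℝ),
          IsSteadyNSState (ν j) F⟦c⟧ u p ∧ ∫ x, u x = m j ∧ ¬ IsLinNSEigenvalue (ν j) u 0 ∧
            ∫ x, ‖u x‖ ^ 2 < E ∧ ε < ν j * gradNormSq u})) :
    ∃ f : 𝕋³ → E³, IsSmooth f ∧ IsDivFree f ∧ HasZeroMean f ∧
      ∃ (ν : ℕ → ℝ) (E ε : ℝ), (∀ j, 0 < ν j) ∧ Tendsto ν atTop (𝓝 0) ∧ 0 < ε ∧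
        ∀ j, ∃ (u : 𝕋³ → E³) (p : 𝕋³ → ℝ),
          IsSteadyNSState (ν j) f u p ∧ ¬ IsLinNSEigenvalue (ν j) u 0 ∧
            ∫ x, ‖u x‖ ^ 2 < E ∧ ε < ν j * gradNormSq u := by
  obtain ⟨ν, m, E, ε, hν, hν0, hε, U, hUo, hUne, hU⟩ := hR
  haveI : BaireSpace 𝒜 := baireSpace_admissible
  obtain ⟨c, -, hc⟩ := Theorems.BaireStep.baire_skeleton hUo hUne _ hU
  obtain ⟨hs, hdf, hmz⟩ := hD c
  refine ⟨F⟦c⟧, hs, hdf, hmz, ν, E, ε, hν, hν0, hε, fun j => ?_⟩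
  obtain ⟨u, p, hst, -, hnd, hE, hεu⟩ := hc j
  exact ⟨u, p, hst, hnd, hE, hεu⟩

/-- **THE BAIRE BIRTH CLOSES THE CRUX BY NAME: A → B → O → D → X.**  Dense loud steady designer forces, generic leaf-nondegeneracy, openness of
the nondegenerate-loud sets and the force dictionary give the heart (`denseRobustNondegenerateLoud_of_dense`,
`loudNondegenerateSteadyStates_of_robust`), and the LANDED transfer `windyGalerkinSteadyZerothLaw_of_loudNondegenerateSteadyStates`
(Galerkin shadowing of leaf-nondegenerate steady states, strict room in the budgets) turns the heart into
`WindLine.WindyGalerkinSteadyZerothLaw`. -/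
theorem windyGalerkinSteadyZerothLaw_of_baireBirth :
    (∃ (ν : ℕ → ℝ) (m : ℕ → E³) (E ε : ℝ), (∀ j, 0 < ν j) ∧ Tendsto ν atTop (𝓝 0) ∧ 0 < ε ∧
      ∃ U : Set 𝒜, IsOpen U ∧ U.Nonempty ∧
        ∀ j, U ⊆ closure {c : 𝒜 | ∃ (u : 𝕋³ → E³) (p : 𝕋³ → ℝ),
          IsSteadyNSState (ν j) F⟦c⟧ u p ∧ ∫ x, u x = m j ∧
            ∫ x, ‖u x‖ ^ 2 < E ∧ ε < ν j * gradNormSq u}) →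
    (∀ (ν : ℝ) (m : E³), 0 < ν →
      Dense (interior {c : 𝒜 | ∀ (u : 𝕋³ → E³) (p : 𝕋³ → ℝ),
        IsSteadyNSState ν F⟦c⟧ u p → ∫ x, u x = m → ¬ IsLinNSEigenvalue ν u 0})) →
    (∀ (ν : ℝ) (m : E³) (E ε : ℝ), 0 < ν →
      IsOpen {c : 𝒜 | ∃ (u : 𝕋³ → E³) (p : 𝕋³ → ℝ),
        IsSteadyNSState ν F⟦c⟧ u p ∧ ∫ x, u x = m ∧ ¬ IsLinNSEigenvalue ν u 0 ∧
          ∫ x, ‖u x‖ ^ 2 < E ∧ ε < ν * gradNormSq u}) →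
    (∀ c : 𝒜, IsSmooth F⟦c⟧ ∧ IsDivFree F⟦c⟧ ∧ HasZeroMean F⟦c⟧) →
    Summit.AnomalousDissipation.AnomalousDissipation.Theses.WindLine.WindyGalerkinSteadyZerothLaw :=
  fun hA hB hO hD =>
    windyGalerkinSteadyZerothLaw_of_loudNondegenerateSteadyStates
      (loudNondegenerateSteadyStates_of_robust hD (denseRobustNondegenerateLoud_of_dense hA hB hO))

end Summit.AnomalousDissipation.AnomalousDissipation.Theorems.WindLineWindyGalerkinSteadyZerothLaw

end
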